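import Summits.BirchSwinnertonDyer.BirchSwinnertonDyer.Theorems.CongruentShaFreeCutTwoAdicSelmerLocIndex
import Summits.BirchSwinnertonDyer.Rank1Residual.X11b.LocalPrimaryCohomologyEP
import Summits.BirchSwinnertonDyer.Rank1Residual.GaloisImage.PropagatedConditionCount
import Literature.NumberTheory.GaloisCohomology.PoitouTateNumberField
import Literature.NumberTheory.EllipticCurves.SelmerLocalRestrictionKernel
import Literature.NumberTheory.EllipticCurves.Kato2004.LocPKernelRankOneProofs

set_option linter.dupNamespace false
set_option autoImplicit false

/-! # Route `CongruentShaFreeCut` (rung S2) — crux `AnalyticRankOneOfRankOneFiniteShaTwo`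
(stmt-BirchSwinnertonDyer-19080): in rank one, relaxing the Selmer condition at `p` costs a UNIFORM exponent
(part 1 of the proof of (R1) «rank one ∧ `Ш[p^∞]` finite ⇒ `rank_{ℤ_p} H¹(ℤ[1/p], T_pW) ≤ 1»; part 2 =
`Theorems/CongruentShaFreeCutIntegralH1RankLeOne.lean`)

Cell `bsd-cn100`, prover seat `bsd-cn100-s2-c3` g11 (plan g18 RULING-2 (2): (R1) is s2-c3's lane).  Supports,
does not close, stmt-BirchSwinnertonDyer-19080.  Theorems only (no definition, no named fact, no `sorry`).

## Contents

* §0 `natCard_adicCompletionIntegers_quot_span_pow`: `#(ℤ_v / p^k) = p^k` at the place `v` of `ℚ` above `p`.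
* §1 (any number field `K : Type`, finite place `v₀`, prime-power level `n`)
  `relIndex_selmerGroup_kummerOutside_mul_addOrderOf_le`: the COUNTING form of the duality half of
  Jetchev–Skinner–Wan Prop. 3.2.1 — `idx := [H¹_{𝓛,⊤ at v₀}(K, W[n]) : Sel⁽ⁿ⁾] ≠ 0` and
  `idx · ord(loc_{v₀} κ_n(P₁)) ≤ #W(K_{v₀})[n] · #(𝓞_{v₀}/n)`, from seat transfer-2's
  `relIndex_selmerGroup_kummerOutside_le_locIndex_of_facts` fed with the TREE THEOREMS
  `poitouTate_sum_localTatePairing_eq_zero_holds` (Tate's reciprocity law = the easy half of Poitou–Tate,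
  Milne I Thm. 4.10(b) `Im β¹ ⊆ Ker γ¹`) and Tate's local Euler–Poincaré characteristic
  (`LocBridge.localEulerPoincareCharacteristic_adicCompletionEP`), plus `#𝓛_{v₀} = #W(K_{v₀})[n]·#(𝓞_{v₀}/n)`
  (Milne I Lemma 3.3, `natCard_kummerSelmerStructure_inr`);
  `exists_relIndex_selmerGroup_kummerOutside_mul_pow_le`: with `rank_ℤ W(K) = 1` and a functional
  `λ : W(K_{v₀}) → ℤ_p` vanishing exactly on torsion, `idx · p^{k+1−v} ≤ #W(K_{v₀})[p^{k+1}] · #(𝓞_{v₀}/p^{k+1})`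
  for ONE `v` (`= v_p(λ P₁)`) and every `k` (order of `loc κ(P₁)` through the local Kummer sequence).
* §1 (over `ℚ`, `v₀ = p`) **`exists_uniform_nsmul_mem_selmerGroup_of_mem_kummerOutside`**: if
  `rank_ℤ W(ℚ) = 1` there is ONE `N ≠ 0` with `N • H¹_{𝓛, ⊤ at p}(ℚ, W[p^{k+1}]) ⊆ Sel^{(p^{k+1})}(W/ℚ)` for
  every `k` (`λ` = AEC VII.6.3 via the conjunct-11 brick `exists_addMonoidHom_padicInt_adicCompletion`,
  `#(ℤ_p/p^{k+1}) = p^{k+1}`, `#W(ℚ_p)[p^{k+1}] ≤ [W(ℚ_p) : U]` for a torsion-free finite-index `U`).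

DESIGN NOTE (why §1 is split generic/`ℚ`): over `ℚ` the real instances `instDecidableEqRat` and
`DivisionRing.toRatAlgebra` compete with the classical / `adicCompletion` instances baked into the generic
Literature lemmas (`kummerMapTorsion`, `Affine.Point.baseChange`), so every manipulation of points and Kummer
classes is done in generic-`K` lemmas and the `ℚ`-level statements only mention tree constants
(`mordellWeilRank`, `selmerGroup`, `kummerOutside`).

HONEST FRAMING: Galois-cohomology bookkeeping over tree theorems; no named fact; nothing about the
Perrin-Riou formula, crux B, the leaf or BSD.  PARTITION: none — RANK axis.

References: [JetchevSkinnerWan2017] Prop. 3.2.1; [MilneADT2006] I Cor. 2.3, Thm. 2.8, Lemma 3.3,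
Thm. 4.10(b); [SilvermanAEC2009] VII.6.3, VIII.§2, X.§4; [Skinner2020] §2.2. -/

noncomputable section

open scoped Classical NumberField

namespace Summit.BirchSwinnertonDyer.BirchSwinnertonDyer.Theorems.CongruentShaFreeCutSelmerRelaxationUniform

open CategoryTheory Field IsDedekindDomain NumberField Function
open WeierstrassCurve (geomPoints geomTorsion galH1Torsion selmerLocalKer selmerGroup torsionPoints
  torsionGaloisModule kummerMapTorsion kummerMapTorsion_mem_selmerLocalKer)
open Literature.NumberTheory.GaloisRepresentations Literature.NumberTheory.GaloisCohomology
open Literature.NumberTheory.EllipticCurves Literature.NumberTheory.EllipticCurves.Kato2004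
open Literature.NumberTheory.EllipticCurves.Kato2004.EulerSystemValues
open Summit.BirchSwinnertonDyer.Rank1Residual.X11b
open Summit.BirchSwinnertonDyer.BirchSwinnertonDyer.Theorems.CongruentShaFreeCutTwoAdicSelmerLocIndex

/-! ## §0 Local counting at the place above `p` -/

section Local

variable (p : ℕ) [Fact p.Prime]

/-- The rational prime `p` lies in the place `primePlace p` above it. [folklore] -/
theorem natCast_mem_asIdeal_primePlace : (p : 𝓞 ℚ) ∈ (primePlace p).asIdeal :=
  (natCast_mem_asIdeal_iff_eq_primesEquiv_symm (primePlace p) (Fact.out : p.Prime)).mpr rfl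

/-- **`#(ℤ_v / p^k ℤ_v) = p^k`** for the place `v` of `ℚ` above `p` (`p` is a uniformizer of `ℤ_v ≅ ℤ_p`
with residue field `𝔽_p`; induction on `k` through `#(R/(ab)) = #(R/(a))·#(R/(b))`).
[cite: MilneADT2006, Ch. I, Lemma 3.3] -/
theorem natCard_adicCompletionIntegers_quot_span_pow (k : ℕ) :
    Nat.card ((primePlace p).adicCompletionIntegers ℚ ⧸
      Ideal.span {((p ^ k : ℕ) : (primePlace p).adicCompletionIntegers ℚ)}) = p ^ k := by
  have hp : p.Prime := Fact.out
  induction k with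
  | zero =>
    simp only [pow_zero, Nat.cast_one, Ideal.span_singleton_one]
    haveI : Subsingleton ((primePlace p).adicCompletionIntegers ℚ ⧸ (⊤ : Ideal _)) :=
      Ideal.Quotient.subsingleton_iff.mpr rfl
    exact Nat.card_of_subsingleton (0 : _)
  | succ k ih =>
    have ha : ((p ^ k : ℕ) : (primePlace p).adicCompletionIntegers ℚ) ≠ 0 :=
      LocalPoints.natCast_ne_zero (primePlace p) (pow_ne_zero k hp.ne_zero)
    rw [show ((p ^ (k + 1) : ℕ) : (primePlace p).adicCompletionIntegers ℚ) =
        ((p ^ k : ℕ) : (primePlace p).adicCompletionIntegers ℚ) *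
          ((p : ℕ) : (primePlace p).adicCompletionIntegers ℚ) by push_cast; ring,
      Summit.BirchSwinnertonDyer.Rank1Residual.GaloisImage.natCard_quotient_span_singleton_mul' ha, ih,
      WeierstrassCurve.natCard_adicCompletionIntegers_quot_span_prime (natCast_mem_asIdeal_primePlace p), pow_succ]

end Local

/-! ## §1 A uniform exponent sending `H¹_{𝓛, ⊤ at v₀}` into the Selmer group, in positive rank -/

section Generic

variable {K : Type} [Field K] [NumberField K] (W : WeierstrassCurve K) [W.IsElliptic]
variable (n : ℕ) [NeZero n] (v₀ : HeightOneSpectrum (𝓞 K))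

/-- **Counting form of the duality half of Jetchev–Skinner–Wan Prop. 3.2.1** (any number field `K`,
finite place `v₀`, prime-power level `n`, point `P₁ ∈ W(K)`): the index
`idx = [H¹_{𝓛, ⊤ at v₀}(K, W[n]) : Sel⁽ⁿ⁾]` is non-zero and
`idx · ord(loc_{v₀} κ(P₁)) ≤ #W(K_{v₀})[n] · #(𝓞_{v₀}/n)`: indeed `idx ≤ [𝓛_{v₀} : loc Sel] ≤
[𝓛_{v₀} : ⟨loc κ(P₁)⟩]` (transfer-2's `relIndex_selmerGroup_kummerOutside_le_locIndex_of_facts`, fed by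
the tree theorems `poitouTate_sum_localTatePairing_eq_zero_holds` and the local Euler–Poincaré
characteristic) and `#𝓛_{v₀} = #W(K_{v₀})[n] · #(𝓞_{v₀}/n)` (Milne I Lemma 3.3).
[cite: JetchevSkinnerWan2017, Prop. 3.2.1 (proof, arXiv:1512.06894 pp. 10–11)]
[cite: MilneADT2006, Ch. I, Thm. 4.10(b), Thm. 2.8, Lemma 3.3] -/
theorem relIndex_selmerGroup_kummerOutside_mul_addOrderOf_le (hn : IsPrimePow n)
    (hdiv : ∀ P : geomPoints W, ∃ Q : geomPoints W, (n : ℤ) • Q = P) (P₁ : W.toAffine.Point) :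
    (selmerGroup W (n : ℤ)).relIndex (kummerOutside W n {Sum.inr v₀}) ≠ 0 ∧
      0 < addOrderOf (galoisCohomology.res (W.torsionGaloisModule (n : ℤ)) (v₀.adicCompletion K) 1
            (kummerMapTorsion W (n : ℤ) hdiv P₁)) ∧
      (selmerGroup W (n : ℤ)).relIndex (kummerOutside W n {Sum.inr v₀}) *
          addOrderOf (galoisCohomology.res (W.torsionGaloisModule (n : ℤ)) (v₀.adicCompletion K) 1
            (kummerMapTorsion W (n : ℤ) hdiv P₁)) ≤
        Nat.card (nsmulAddMonoidHom n : (W.baseChange (v₀.adicCompletion K)).toAffine.Point →+ _).ker *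
          Nat.card (v₀.adicCompletionIntegers K ⧸ Ideal.span {(n : v₀.adicCompletionIntegers K)}) := by
  classical
  haveI : PerfectField K := PerfectField.ofCharZero
  haveI : CharZero (v₀.adicCompletion K) := charZero_adicCompletion v₀
  haveI : Finite (geomTorsion W n) := finite_geomTorsion_of_neZero W n
  -- notation (as in `CongruentShaFreeCutTwoAdicSelmerLocIndex`)
  set M := W.torsionGaloisModule (n : ℤ) with hM
  set loc := galoisCohomology.localization M (Sum.inr v₀) 1 with hloc
  set L := W.kummerSelmerStructure (n : ℤ) (Sum.inr v₀) with hL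
  set KO := kummerOutside W n {Sum.inr v₀} with hKO
  set Sel := selmerGroup W (n : ℤ) with hSeldef
  set HS := Sel.map loc with hHS
  haveI hfinA : Finite (galoisCohomology (M.toLocal (Sum.inr v₀)) 1) := by
    change Finite (galoisCohomology (GaloisRep.restrictField (v₀.adicCompletion K)
      (W.torsionGaloisModule (n : ℤ))) 1)
    exact finite_galoisCohomology_one_of_isNonarchimedeanLocalField _
  -- `idx ≠ 0`: it is a relative index inside the finite local group
  have hSel : Sel = L.comap loc ⊓ KO := by
    apply le_antisymm
    · intro c hc
      exact ⟨(W.mem_selmerGroup_iff_forall_localization_mem (n : ℤ) c).mp hc (Sum.inr v₀),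
        selmerGroup_le_kummerOutside W n _ hc⟩
    · rintro c ⟨hc₀, hcKO⟩
      refine mem_selmerGroup_of_mem_kummerOutside W n hcKO fun w => ?_
      obtain ⟨w, hw⟩ := w
      rw [Finset.mem_singleton] at hw
      subst hw
      exact hc₀
  have h2' : (L.comap loc ⊓ KO).relIndex KO = L.relIndex (L ⊔ KO.map loc) := by
    rw [AddSubgroup.inf_relIndex_right, AddSubgroup.relIndex_comap, AddSubgroup.relIndex_sup_left]
  have hidx_eq : Sel.relIndex KO = L.relIndex (L ⊔ KO.map loc) := by
    rw [hSel]; exact h2'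
  haveI hfinSup : Finite ↥(L ⊔ KO.map loc) := Subtype.finite
  have hidx0 : Sel.relIndex KO ≠ 0 := by
    rw [hidx_eq]
    exact AddSubgroup.FiniteIndex.index_ne_zero
  -- `idx ≤ [L : HS]` (transfer-2's duality half, with both facts discharged)
  have hle₁ : Sel.relIndex KO ≤ HS.relIndex L :=
    relIndex_selmerGroup_kummerOutside_le_locIndex_of_facts W n v₀ hn
      (poitouTate_sum_localTatePairing_eq_zero_holds K)
      (LocBridge.localEulerPoincareCharacteristic_adicCompletionEP K v₀)
  -- the cyclic subgroup `Z = ⟨loc κ(P₁)⟩ ≤ HS ≤ L`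
  have hz₁Sel : kummerMapTorsion W (n : ℤ) hdiv P₁ ∈ Sel :=
    (WeierstrassCurve.mem_selmerGroup_iff W (n : ℤ) _).mpr
      ⟨fun w => kummerMapTorsion_mem_selmerLocalKer W (n : ℤ) hdiv _ P₁,
        fun w => kummerMapTorsion_mem_selmerLocalKer W (n : ℤ) hdiv _ P₁⟩
  set Z : AddSubgroup (galoisCohomology (M.toLocal (Sum.inr v₀)) 1) :=
    AddSubgroup.zmultiples (loc (kummerMapTorsion W (n : ℤ) hdiv P₁)) with hZ
  have hZHS : Z ≤ HS := by
    rw [hZ, AddSubgroup.zmultiples_le]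
    exact AddSubgroup.mem_map_of_mem loc hz₁Sel
  have hHSL : HS ≤ L := by
    rintro _ ⟨s, hs, rfl⟩
    exact (W.mem_selmerGroup_iff_forall_localization_mem (n : ℤ) s).mp hs (Sum.inr v₀)
  have hZL : Z ≤ L := hZHS.trans hHSL
  -- `[L : HS] ≤ [L : Z]`
  haveI hfinL : Finite L := Subtype.finite
  have hZidx0 : Z.relIndex L ≠ 0 := AddSubgroup.FiniteIndex.index_ne_zero
  have hle₂ : HS.relIndex L ≤ Z.relIndex L :=
    Nat.le_of_dvd (Nat.pos_of_ne_zero hZidx0) (AddSubgroup.relIndex_dvd_of_le_left L hZHS)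
  -- `[L : Z] · #Z = #L`, `#Z = ord (loc κ P₁)`, `#L = #W(K_v)[n] · #(𝓞_v/n)`
  have hLZ : Z.relIndex L * Nat.card Z = Nat.card L := by
    rw [AddSubgroup.relIndex, mul_comm, ← Nat.card_congr (AddSubgroup.addSubgroupOfEquivOfLe hZL).toEquiv]
    exact AddSubgroup.card_mul_index _
  have hZcard : Nat.card Z = addOrderOf (loc (kummerMapTorsion W (n : ℤ) hdiv P₁)) :=
    Nat.card_zmultiples _
  have hLcard : Nat.card L = Nat.card (nsmulAddMonoidHom n :
        (W.baseChange (v₀.adicCompletion K)).toAffine.Point →+ _).ker *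
      Nat.card (v₀.adicCompletionIntegers K ⧸ Ideal.span {(n : v₀.adicCompletionIntegers K)}) :=
    W.natCard_kummerSelmerStructure_inr v₀ (NeZero.ne n)
  have hpos : 0 < addOrderOf (loc (kummerMapTorsion W (n : ℤ) hdiv P₁)) :=
    addOrderOf_pos_iff.mpr (isOfFinAddOrder_of_finite _)
  -- `res … = loc` definitionally; assemble without rewriting inside the mixed-instance goal
  have e1 : addOrderOf (galoisCohomology.res (W.torsionGaloisModule (n : ℤ)) (v₀.adicCompletion K) 1
      (kummerMapTorsion W (n : ℤ) hdiv P₁)) = Nat.card Z := hZcard.symm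
  refine ⟨hidx0, hpos, ?_⟩
  calc Sel.relIndex KO * addOrderOf (galoisCohomology.res (W.torsionGaloisModule (n : ℤ))
          (v₀.adicCompletion K) 1 (kummerMapTorsion W (n : ℤ) hdiv P₁))
        = Sel.relIndex KO * Nat.card Z := congrArg (fun x => Sel.relIndex KO * x) e1
    _ ≤ Z.relIndex L * Nat.card Z := Nat.mul_le_mul_right _ (hle₁.trans hle₂)
    _ = Nat.card L := hLZ
    _ = _ := hLcard

/-- **Rank one: a uniform bound `[H¹_{𝓛,⊤ at v₀} : Sel⁽ⁿ⁾] · p^{k+1−v} ≤ #W(K_{v₀})[n] · #(𝓞_{v₀}/n)`**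
(`n = p^{k+1}`, `v` independent of `k`), for any number field `K`, finite place `v₀` and a functional
`λ : W(K_{v₀}) → ℤ_p` vanishing exactly on torsion: with `W(K) = ℤP₁ + tors` (rank one), the order of
`loc_{v₀} κ_n(P₁)` is divisible by `p^{k+1−v_p(λ P₁)}` (if `m·loc κ(P₁) = 0` then `mP₁ ∈ n·W(K_{v₀})` by
the local Kummer sequence, so `p^{k+1} ∣ m·λ(P₁)`), and §1's counting form applies.
[cite: JetchevSkinnerWan2017, Prop. 3.2.1] [cite: SilvermanAEC2009, Prop. VII.6.3, VIII.§2 and X.§4] -/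
theorem exists_relIndex_selmerGroup_kummerOutside_mul_pow_le (p : ℕ) [Fact p.Prime]
    (lam : (W.baseChange (v₀.adicCompletion K)).toAffine.Point →+ ℤ_[p])
    (hlam : ∀ X, lam X = 0 ↔ IsOfFinAddOrder X) (hrank : W.mordellWeilRank = 1) :
    ∃ v : ℕ, ∀ (k : ℕ) (m : ℕ) [NeZero m], m = p ^ (k + 1) →
      (selmerGroup W (m : ℤ)).relIndex (kummerOutside W m {Sum.inr v₀}) ≠ 0 ∧
        (selmerGroup W (m : ℤ)).relIndex (kummerOutside W m {Sum.inr v₀}) * p ^ (k + 1 - v) ≤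
          Nat.card (nsmulAddMonoidHom m : (W.baseChange (v₀.adicCompletion K)).toAffine.Point →+ _).ker *
            Nat.card (v₀.adicCompletionIntegers K ⧸ Ideal.span {(m : v₀.adicCompletionIntegers K)}) := by
  have hp : p.Prime := Fact.out
  haveI : PerfectField (v₀.adicCompletion K) := by
    haveI : CharZero (v₀.adicCompletion K) := charZero_adicCompletion v₀
    exact PerfectField.ofCharZero
  -- the rank-one generator and the valuation of `λ(P₁)`
  obtain ⟨P₁, hP₁, -⟩ := exists_generator_of_mordellWeilRank_eq_one W hrank
  let bc : W.toAffine.Point →+ (W.baseChange (v₀.adicCompletion K)).toAffine.Point :=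
    WeierstrassCurve.Affine.Point.baseChange (W' := W) K (v₀.adicCompletion K)
  have hinj : Function.Injective bc :=
    WeierstrassCurve.Affine.Point.map_injective (W' := W) (Algebra.ofId K _)
  have hu0 : lam (bc P₁) ≠ 0 := by
    intro h0
    apply hP₁
    obtain ⟨m, hm, hmP⟩ := isOfFinAddOrder_iff_nsmul_eq_zero.mp ((hlam _).mp h0)
    refine isOfFinAddOrder_iff_nsmul_eq_zero.mpr ⟨m, hm, hinj ?_⟩
    rw [map_nsmul, map_zero]
    exact hmP
  refine ⟨(lam (bc P₁)).valuation, fun k n _ hn => ?_⟩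
  set v : ℕ := (lam (bc P₁)).valuation with hv
  have hnpp : IsPrimePow n := by rw [hn]; exact hp.isPrimePow.pow (Nat.succ_ne_zero k)
  have hn0 : (n : ℤ) ≠ 0 := Int.natCast_ne_zero.mpr (NeZero.ne n)
  have hdiv : ∀ P : geomPoints W, ∃ Q : geomPoints W, (n : ℤ) • Q = P :=
    fun P => W.zsmul_geomPoints_surjective_holds hn0 P
  obtain ⟨hidx0, hmpos, hcount⟩ :=
    relIndex_selmerGroup_kummerOutside_mul_addOrderOf_le W n v₀ hnpp hdiv P₁
  refine ⟨hidx0, ?_⟩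
  -- `p^{k+1-v} ∣ ord (loc κ P₁)`
  let r : galH1Torsion W (n : ℤ) →+
      galoisCohomology (GaloisRep.restrictField (v₀.adicCompletion K) (W.torsionGaloisModule (n : ℤ))) 1 :=
    galoisCohomology.res (W.torsionGaloisModule (n : ℤ)) (v₀.adicCompletion K) 1
  obtain ⟨m, hm⟩ : ∃ m : ℕ, m = addOrderOf (r (kummerMapTorsion W (n : ℤ) hdiv P₁)) := ⟨_, rfl⟩
  have hord_dvd : p ^ (k + 1 - v) ∣ m := by
    have hres : r (kummerMapTorsion W (n : ℤ) hdiv (m • P₁)) = 0 := by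
      rw [map_nsmul, map_nsmul, hm]
      exact addOrderOf_nsmul_eq_zero _
    obtain ⟨R, hR⟩ := exists_baseChange_eq_zsmul_of_res_kummerMapTorsion_eq_zero W hdiv
      (v₀.adicCompletion K) (m • P₁) hres
    have h1 : (m : ℤ_[p]) * lam (bc P₁) = ((n : ℤ) : ℤ_[p]) * lam R := by
      have h := congrArg lam hR
      change lam (bc (m • P₁)) = lam ((n : ℤ) • R) at h
      simp only [map_nsmul, map_zsmul] at h
      rw [nsmul_eq_mul, zsmul_eq_mul] at h
      exact h
    have hdvd : (p : ℤ_[p]) ^ (k + 1) ∣ ((m : ℤ) : ℤ_[p]) * lam (bc P₁) := by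
      refine ⟨lam R, ?_⟩
      rw [Int.cast_natCast, h1, hn]
      push_cast
      ring
    have h := pow_sub_valuation_dvd_of_pow_dvd_mul p hu0 hdvd
    rw [← hv] at h
    exact_mod_cast h
  have hm0 : m ≠ 0 := by rw [hm]; exact hmpos.ne'
  calc (selmerGroup W (n : ℤ)).relIndex (kummerOutside W n {Sum.inr v₀}) * p ^ (k + 1 - v)
      ≤ (selmerGroup W (n : ℤ)).relIndex (kummerOutside W n {Sum.inr v₀}) * m :=
        Nat.mul_le_mul_left _ (Nat.le_of_dvd (Nat.pos_of_ne_zero hm0) hord_dvd)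
    _ ≤ _ := by rw [hm]; exact hcount

end Generic

section Relax

variable (W : WeierstrassCurve ℚ) [W.IsElliptic] (p : ℕ) [Fact p.Prime]

/-- **Rank one over `ℚ`: relaxing the Selmer condition at `p` costs a UNIFORM exponent.**  If
`rank_ℤ W(ℚ) = 1`, there is `N ≠ 0` such that for every `k` and every `c ∈ H¹(ℚ, W[p^{k+1}])` satisfying
the Kummer local condition at every place `≠ p` (`kummerOutside … {p}`), `N • c ∈ Sel^{(p^{k+1})}(W/ℚ)`.
From the generic bound of §1 at `v₀ = p` with `λ : W(ℚ_p) → ℤ_p` (AEC VII.6.3, the conjunct-11 brick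
`exists_addMonoidHom_padicInt_adicCompletion`), `#(ℤ_p/p^{k+1}) = p^{k+1}` and
`#W(ℚ_p)[p^{k+1}] ≤ [W(ℚ_p) : U]` for a torsion-free `U` of finite index: `N = ([W(ℚ_p) : U] · p^v)!`.
[cite: JetchevSkinnerWan2017, Prop. 3.2.1 (proof, arXiv:1512.06894 pp. 10–11)]
[cite: MilneADT2006, Ch. I, Thm. 4.10(b), Thm. 2.8, Lemma 3.3] [cite: SilvermanAEC2009, Prop. VII.6.3 and X.§4] -/
theorem exists_uniform_nsmul_mem_selmerGroup_of_mem_kummerOutside (hrank : W.mordellWeilRank = 1) :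
    ∃ N : ℕ, N ≠ 0 ∧ ∀ (k : ℕ) (c : galH1Torsion W ((p ^ (k + 1) : ℕ) : ℤ)),
      c ∈ kummerOutside W (p ^ (k + 1)) {Sum.inr (primePlace p)} →
        N • c ∈ selmerGroup W ((p ^ (k + 1) : ℕ) : ℤ) := by
  have hp : p.Prime := Fact.out
  -- `λ : W(ℚ_v) → ℤ_p` vanishing exactly on torsion; the generic bound of §1
  obtain ⟨lam, hlam⟩ := exists_addMonoidHom_padicInt_adicCompletion W p
  obtain ⟨v, hv⟩ := exists_relIndex_selmerGroup_kummerOutside_mul_pow_le W (primePlace p) p lam hlam hrank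
  -- a torsion-free finite-index subgroup `U ≤ W(ℚ_v)` (AEC VII.6.3) and its index `t`
  obtain ⟨U, hU, htf, -⟩ := W.exists_finiteIndex_torsionFree_adicCompletion (primePlace p)
  haveI := hU
  obtain ⟨t, ht⟩ : ∃ t : ℕ, t = U.index := ⟨_, rfl⟩
  have ht0 : t ≠ 0 := by rw [ht]; exact hU.index_ne_zero
  refine ⟨(t * p ^ v).factorial, Nat.factorial_ne_zero _, fun k c hc => ?_⟩
  -- work at a level `n` with `n = p^{k+1}` kept as an equation (the level indexes dependent types)
  suffices key : ∀ (n : ℕ) [NeZero n], n = p ^ (k + 1) → ∀ c : galH1Torsion W (n : ℤ),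
      c ∈ kummerOutside W n {Sum.inr (primePlace p)} →
        (t * p ^ v).factorial • c ∈ selmerGroup W (n : ℤ) by
    haveI : NeZero (p ^ (k + 1)) := ⟨pow_ne_zero _ hp.ne_zero⟩
    exact key (p ^ (k + 1)) rfl c hc
  intro n _ hn c hc
  obtain ⟨hidx0, hcount⟩ := hv k n hn
  obtain ⟨idx, hidx⟩ : ∃ idx : ℕ,
      idx = (selmerGroup W (n : ℤ)).relIndex (kummerOutside W n {Sum.inr (primePlace p)}) := ⟨_, rfl⟩
  rw [← hidx] at hidx0 hcount
  have hidxmem : idx • c ∈ selmerGroup W (n : ℤ) := by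
    rw [hidx]; exact AddSubgroup.nsmul_relIndex_mem _ hc
  -- `#W(ℚ_v)[n] ≤ t` (the `n`-torsion injects into `W(ℚ_v)/U`) and `#(ℤ_v/n) = p^{k+1}`
  have hker : Nat.card (nsmulAddMonoidHom n :
      (W.baseChange ((primePlace p).adicCompletion ℚ)).toAffine.Point →+ _).ker ∣ t := by
    let f : (nsmulAddMonoidHom n : (W.baseChange ((primePlace p).adicCompletion ℚ)).toAffine.Point →+ _).ker →+
        _ ⧸ U := (QuotientAddGroup.mk' U).comp (AddSubgroup.subtype _)
    have hf : Function.Injective f := by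
      refine (injective_iff_map_eq_zero f).mpr fun a ha => ?_
      have hmem : (a : (W.baseChange ((primePlace p).adicCompletion ℚ)).toAffine.Point) ∈ U :=
        (QuotientAddGroup.eq_zero_iff _).mp ha
      have hna : n • (a : (W.baseChange ((primePlace p).adicCompletion ℚ)).toAffine.Point) = 0 := a.2
      exact Subtype.ext (htf n (NeZero.ne n) _ hmem hna)
    rw [ht]
    exact AddSubgroup.card_dvd_of_injective f hf
  have hquot : Nat.card ((primePlace p).adicCompletionIntegers ℚ ⧸
      Ideal.span {(n : (primePlace p).adicCompletionIntegers ℚ)}) = p ^ (k + 1) := by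
    rw [hn]
    exact natCard_adicCompletionIntegers_quot_span_pow p (k + 1)
  -- combine: `idx · p^{k+1-v} ≤ t · p^{k+1} ≤ (t p^v) · p^{k+1-v}`, so `idx ≤ t p^v`
  have hpow : p ^ (k + 1) ≤ p ^ v * p ^ (k + 1 - v) := by
    rw [← pow_add]
    exact Nat.pow_le_pow_right hp.pos (by omega)
  have hidxle : idx ≤ t * p ^ v := by
    have hpos : 0 < p ^ (k + 1 - v) := pow_pos hp.pos _
    refine Nat.le_of_mul_le_mul_right ?_ hpos
    calc idx * p ^ (k + 1 - v)
        ≤ Nat.card (nsmulAddMonoidHom n :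
            (W.baseChange ((primePlace p).adicCompletion ℚ)).toAffine.Point →+ _).ker *
          Nat.card ((primePlace p).adicCompletionIntegers ℚ ⧸
            Ideal.span {(n : (primePlace p).adicCompletionIntegers ℚ)}) := hcount
      _ ≤ t * p ^ (k + 1) := by
          rw [hquot]; exact Nat.mul_le_mul_right _ (Nat.le_of_dvd (Nat.pos_of_ne_zero ht0) hker)
      _ ≤ t * (p ^ v * p ^ (k + 1 - v)) := Nat.mul_le_mul_left _ hpow
      _ = t * p ^ v * p ^ (k + 1 - v) := by ring
  -- so `idx ∣ (t · p^v)!` and `N • c ∈ Sel`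
  obtain ⟨q, hq⟩ := Nat.dvd_factorial (Nat.pos_of_ne_zero hidx0) hidxle
  rw [hq, mul_comm, mul_nsmul']
  exact AddSubgroup.nsmul_mem _ hidxmem q

end Relax

end Summit.BirchSwinnertonDyer.BirchSwinnertonDyer.Theorems.CongruentShaFreeCutSelmerRelaxationUniform

end
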